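import Literature.MathematicalPhysics.QuantumFieldTheory.ConformalBootstrap3D.PointKernelK34L505Data
import Literature.MathematicalPhysics.QuantumFieldTheory.ConformalBootstrap3D.PointKernelK34L505Segs

/-!
# K34L505 certificate, kernel block file E2: `ε`-row segments (interval coefficient rule; block checker `PCert.hBlockOKI` of `PointKernelInterval`, soundness `PCert.hBlockOKI_sound`), segments `16 ≤ i < 25`

`decide` by kernel reduction (no `native_decide`, no extra axioms) on the literal data of
`PointKernelK34L505Data`, on the certificate itself (full `s`-width) or on its piece certificates
`pcP_i = certK34L505.withS σ_i σ_(i+1) …` (the cell numbers on an `s`-piece; assembled by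
`CellFactIS_of_pieces`).  Estimated kernel time 246 s (5 theorems).
-/

set_option maxRecDepth 100000
set_option maxHeartbeats 0

namespace Literature.MathematicalPhysics.QuantumFieldTheory.ConformalBootstrap3D.PointKernelK34L505

open Literature.MathematicalPhysics.QuantumFieldTheory.ConformalBootstrap3D.PointKernel

/-- segments `[16, 18)` of `esegsK34L505` pass the kernel evaluator (≈52 s of kernel work). [folklore] -/
theorem eBlock_16 : certK34L505.hBlockOKI esegsK34L505 16 18 JEK34L505 = true := by
  decide +kernel

/-- segments `[18, 20)` of `esegsK34L505` pass the kernel evaluator (≈52 s of kernel work). [folklore] -/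
theorem eBlock_18 : certK34L505.hBlockOKI esegsK34L505 18 20 JEK34L505 = true := by
  decide +kernel

/-- segments `[20, 22)` of `esegsK34L505` pass the kernel evaluator (≈52 s of kernel work). [folklore] -/
theorem eBlock_20 : certK34L505.hBlockOKI esegsK34L505 20 22 JEK34L505 = true := by
  decide +kernel

/-- segments `[22, 24)` of `esegsK34L505` pass the kernel evaluator (≈52 s of kernel work). [folklore] -/
theorem eBlock_22 : certK34L505.hBlockOKI esegsK34L505 22 24 JEK34L505 = true := by
  decide +kernel

/-- segment `[24, 25)` of `esegsK34L505` passes the kernel evaluator (≈26 s of kernel work). [folklore] -/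
theorem eBlock_24 : certK34L505.hBlockOKI esegsK34L505 24 25 JEK34L505 = true := by
  decide +kernel

end Literature.MathematicalPhysics.QuantumFieldTheory.ConformalBootstrap3D.PointKernelK34L505
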